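import Summits.CriticalPhenomena.Ising3DConformalLimit.Theses.UnitLightCone
import Summits.CriticalPhenomena.Ising3DConformalLimit.Theses.MirrorHoelderCompactness
import Summits.CriticalPhenomena.Ising3DConformalLimit.Theorems.HyperoctahedralRPExistsScaleCovariantLimitFunnelDoublingIffAxisRate
import Literature.Probability.LatticeModels.CriticalAxisRatioRegularity
import Literature.Probability.LatticeModels.MessagerMiracleSole
import Literature.Probability.LatticeModels.CriticalTwoPointLower
import HarnessLib.Audit.Check

/-!
# Line `curvature-split` for crux `TwoPointDoubling` (stmt-CriticalPhenomena-6150), route `UnitLightCone`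
# (strategist b1, `--alt`; a typed DECOMPOSITION BY MECHANISM with the glue proved in this file)

Crux: `∃ κ > 0, ∀ n ≥ 1, κ·g(n) ≤ g(2n)`, `g(n) = criticalTwoPoint 3 (Pi.single 0 n) = ⟨σ₀σ_{ne₀}⟩⁺_{β_c(3)}` (ADC21 Rem. 5.10, open).

## The cut.  For the completely monotone axis profile `g` (reflection positivity; in tree as log-convexity
`criticalTwoPoint_axis_sq_le`), the crux is EQUIVALENT to the second-order AXIAL CURVATURE BOUND `δ²g(k) := g(k+1) − 2g(k) + g(k−1)
≤ A·g(k)/k²` (⇐ is proved here: log-convexity `g(k)² ≤ g(k−1)g(k+1)` is literally `(g(k) − g(k+1))² ≤ g(k+1)·δ²g(k)`, whence the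
log-free gradient bound `g(k) − g(k+1) ≤ √A·g(k)/k` of ADC21 Remark 5.10, which is the crux by the landed
`Funnel.twoPointDoubling_iff_axisGradientRate`; ⇒ by the rate form and monotonicity of the increments).  Now split the axial second
difference through the six-neighbour LAPLACIAN at `ke₀`:

    δ²g(k) = ΔG(ke₀) + D(k),   ΔG(ke₀) = Σ_{y ∼ ke₀} G(y) − 6 g(k),   D(k) = 4 g(k) − Σ_{transverse y ∼ ke₀} G(y) ≥ 0 (MMS).

* `stub_axialKato` (piece (i)): `ΔG(ke₀) ≤ A·g(k)/k²` — NO POSITIVE EFFECTIVE MASS ON THE AXIS.  A CONSEQUENCE of the crux (the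
  transverse part of the Laplacian is `≤ 0`), hence strictly on the way; by the one-site DLR equation it is the inequality
  `⟨σ₀ Ψ_{ke₀}⟩ ≤ A⟨σ₀σ_{ke₀}⟩/k²`, `Ψ_x = S_x − 6 tanh(β_c S_x)`, between correlations of the far spin with odd local functions of the
  six neighbours (line `superharmonic-comparison` states the all-`x` version and its comparison-principle transfer).
* `stub_transverseDipole` (piece (ii)): `g(k) − G(ke₀ + 2e₁) ≤ A·g(k)/k²` — the TRANSVERSE CURVATURE of `G` at the axis is second
  order.  By cubic symmetry and MMS (`G(ke₀ ± e₁) = G(ke₀ ± e₂) ≥ G(ke₀ + 2e₁)`) it bounds `D(k) ≤ 4A g(k)/k²`.  In Aizenman's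
  folded-current language (arXiv:2509.02850 Thm 14.2; tree `FoldedCurrentRepulsion.stub_foldedIdentity` for coordinate mirrors, here the
  site plane `{x₁ = 1}` at distance 1 from BOTH sources `0` and `ke₀`): the sourced critical cluster avoids a plane adjacent to both its
  sources with probability `≤ A/k²` — a TWO-ENDED ("dipole") avoidance, versus the ONE-ENDED avoidance `≤ A/k` which IS the crux
  (`wallRepulsion_iff_twoPointDoubling`).  For the Gaussian free field the number is `1 − k/√(k²+4) ≈ 2/k²`; for the expected profile
  `|x|^{−(1+η)}` it is `2(1+η)/k² ≈ 2.07/k²`.  Known today only to first order (`≤ 1 − g(k+2)/g(k) ≤ (log k + A)/k`, MMS + the √n machinery).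
* `TwoPointDoubling_of` (REAL PROOF, this file): (i) + (ii) ⟹ `δ²g(k) ≤ (A₁ + 4A₂) g(k)/k²` ⟹ gradient rate `√(A₁+4A₂)` ⟹ crux.

What the cut buys.  It separates the two things a second difference at scale `k` can see: a positive MASS term (piece (i), one-sided,
local, DLR-expressible, necessary) and the transverse BENDING of the level sets (piece (ii), geometric: a two-ended confinement
probability with product structure).  Neither piece is a two-point PROFILE fact (the barrier
`Literature.Barriers.CriticalPhenomena.AxisProfileAxiomaticsNoDoubling` quantifies over the axis sequence only; (i) and (ii) involve
off-axis values `G(ke₀ + eᵢ)`, `G(ke₀ + 2e₁)` at fixed `k`, about which MMS gives only `g(k+2) ≤ · ≤ g(k)`), and neither is known to be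
equivalent to the crux ((i) is implied by it; (ii) is its transverse twin, implied by it only together with a LOWER Kato bound
`ΔG(ke₀) ≥ −B g(k)/k²`, itself open).  Honest: (ii) is as deep as the crux by present knowledge; the line is registered as the typed
decomposition of record so that either piece can be attacked, grounded or refuted on its own.

Disproof used: none on file for this crux (no Disproof.lean, no `_false_without_`, no Negative/).  Negatives index: 11 CriticalPhenomena
refutations (Cardy/percolation/SAW), none on `criticalTwoPoint 3`.  Not costume: neither stub restates the crux, the summit or a refuted
statement; BC3-type probes `stub → crux`, `stub → Ising3DConformalLimit` by `first | exact? | simpa | aesop` fail (line card).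
-/

noncomputable section

namespace Summit.CriticalPhenomena.Ising3DConformalLimit.Cruxes.TwoPointDoubling.CurvatureSplit

open scoped BigOperators
open Finset Real Filter
open Literature.Probability.LatticeModels
open Summit.CriticalPhenomena.Ising3DConformalLimit.Theses
open Summit.CriticalPhenomena.Ising3DConformalLimit.Cruxes.ExistsScaleCovariantLimit

/-! ## The two registered stubs (signatures fully qualified, over importable vocabulary only) -/

/-- **STUB 1 · `stub_axialKato` (OPEN; a consequence of the crux) — no positive effective mass on the axis.**
`∃ A, ∀ k ≥ 1, Σ_{i} (G(ke₀ + eᵢ) + G(ke₀ − eᵢ)) − 6 G(ke₀) ≤ A·G(ke₀)/k²`, `G = criticalTwoPoint 3`: the six-neighbour Laplacian of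
the critical two-point function at the axis point `ke₀` is at most `A g(k)/k²`.  DLR form: `⟨σ₀ (S_x − 6 tanh(β_c S_x))⟩ ≤ A⟨σ₀σ_x⟩/k²`
at `x = ke₀`.  [AizenmanDuminilCopinAnnals2021 Rem. 5.10; FriedliVelenik2017 Ch. 6 (DLR); crux idea card harnack-effective-mass] -/
theorem stub_axialKato :
    ∃ A : ℝ, ∀ k : ℕ, 1 ≤ k →
      (∑ i : Fin 3, (Literature.Probability.LatticeModels.criticalTwoPoint 3 (Pi.single 0 (k : ℤ) + Pi.single i 1) +
          Literature.Probability.LatticeModels.criticalTwoPoint 3 (Pi.single 0 (k : ℤ) - Pi.single i 1))) -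
        6 * Literature.Probability.LatticeModels.criticalTwoPoint 3 (Pi.single 0 (k : ℤ)) ≤
        A * Literature.Probability.LatticeModels.criticalTwoPoint 3 (Pi.single 0 (k : ℤ)) / (k : ℝ) ^ 2 := by
  sorry

/-- **STUB 2 · `stub_transverseDipole` (OPEN; the transverse twin of the crux) — transverse curvature at the axis is second order.**
`∃ A, ∀ k ≥ 1, G(ke₀) − G(ke₀ + 2e₁) ≤ A·G(ke₀)/k²`: in the folded-current dictionary the sourced critical cluster (sources `0`, `ke₀`)
avoids the adjacent plane `{x₁ = 1}` with probability `≤ A/k²` (two-ended avoidance; GFF value `2/k²`, expected `2(1+η)/k²`).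
[arXiv:2509.02850 Thm 14.2 / Lemma 14.3 (folded identity); AizenmanDuminilCopinAnnals2021 §5.1 (MMS), Rem. 5.10] -/
theorem stub_transverseDipole :
    ∃ A : ℝ, ∀ k : ℕ, 1 ≤ k →
      Literature.Probability.LatticeModels.criticalTwoPoint 3 (Pi.single 0 (k : ℤ)) -
          Literature.Probability.LatticeModels.criticalTwoPoint 3 (Pi.single 0 (k : ℤ) + Pi.single 1 2) ≤
        A * Literature.Probability.LatticeModels.criticalTwoPoint 3 (Pi.single 0 (k : ℤ)) / (k : ℝ) ^ 2 := by
  sorry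

/-! ## Names for the statements (hypotheses of the composition) -/

namespace Statement

/-- Statement of `stub_axialKato`. -/
abbrev stub_axialKato : Prop := type_of% CurvatureSplit.stub_axialKato
/-- Statement of `stub_transverseDipole`. -/
abbrev stub_transverseDipole : Prop := type_of% CurvatureSplit.stub_transverseDipole

end Statement

/-! ## Local shorthand and elementary facts (proved) -/

/-- `g(m) = ⟨σ₀σ_{m e₀}⟩⁺_{β_c(3)}`. -/
def g (m : ℕ) : ℝ := criticalTwoPoint 3 (Pi.single 0 (m : ℤ))

theorem g_pos (m : ℕ) : 0 < g m := Funnel.criticalTwoPoint_axis_pos 0 m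

/-- The axial curvature bound `δ²g(k) ≤ A g(k)/k²`. -/
def AxialCurvatureBound : Prop :=
  ∃ A : ℝ, ∀ k : ℕ, 1 ≤ k →
    criticalTwoPoint 3 (Pi.single 0 ((k + 1 : ℕ) : ℤ)) - 2 * criticalTwoPoint 3 (Pi.single 0 (k : ℤ)) +
        criticalTwoPoint 3 (Pi.single 0 ((k - 1 : ℕ) : ℤ)) ≤
      A * criticalTwoPoint 3 (Pi.single 0 (k : ℤ)) / (k : ℝ) ^ 2

/-- Lattice symmetries and MMS for `criticalTwoPoint 3` (tree: `twoPointPlus_reflection_invariant_holds`,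
`twoPointPlus_perm_invariant_holds`, `messager_miracleSole_holds`). [FriedliVelenik2017 Exercise 3.14, §3.10.6] -/
theorem criticalTwoPoint_symm_facts :
    (∀ (j : Fin 3) (x : Site 3), criticalTwoPoint 3 (Function.update x j (-x j)) = criticalTwoPoint 3 x) ∧
    (∀ (p : Equiv.Perm (Fin 3)) (x : Site 3), criticalTwoPoint 3 (fun i => x (p i)) = criticalTwoPoint 3 x) ∧
    (∀ (x : Site 3) (i : Fin 3), 0 ≤ x i → criticalTwoPoint 3 (x + Pi.single i 1) ≤ criticalTwoPoint 3 x) := by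
  have hβ : 0 ≤ criticalBeta 3 := criticalBeta_nonneg 3
  refine ⟨fun j x => ?_, fun p x => ?_, fun x i hx => ?_⟩
  · exact twoPointPlus_reflection_invariant_holds (d := 3) hβ j x
  · exact twoPointPlus_perm_invariant_holds (d := 3) hβ p x
  · exact messager_miracleSole_holds (d := 3) (β := criticalBeta 3) hβ x i hx

/-- The four transverse neighbours of `k e₀` all carry `G(ke₀ + e₁) ≥ G(ke₀ + 2e₁)` (cubic symmetry + MMS). [folklore] -/
theorem transverse_nbrs_ge (k : ℕ) :
    4 * criticalTwoPoint 3 (Pi.single 0 (k : ℤ) + Pi.single 1 2) ≤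
      ∑ i : Fin 3, if i = 0 then 0 else
        (criticalTwoPoint 3 (Pi.single 0 (k : ℤ) + Pi.single i 1) +
          criticalTwoPoint 3 (Pi.single 0 (k : ℤ) - Pi.single i 1)) := by
  obtain ⟨hrefl, hperm, hmms⟩ := criticalTwoPoint_symm_facts
  set x₀ : Site 3 := Pi.single 0 (k : ℤ) with hx₀
  have h21 : criticalTwoPoint 3 (x₀ + Pi.single 1 2) ≤ criticalTwoPoint 3 (x₀ + Pi.single 1 1) := by
    have := hmms (x₀ + Pi.single 1 1) 1 (by simp [hx₀])
    have heq : x₀ + Pi.single 1 1 + Pi.single 1 1 = x₀ + Pi.single (1 : Fin 3) (2 : ℤ) := by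
      rw [add_assoc, ← Pi.single_add]; norm_num
    rwa [heq] at this
  have hneg : ∀ i : Fin 3, i ≠ 0 →
      criticalTwoPoint 3 (x₀ - Pi.single i 1) = criticalTwoPoint 3 (x₀ + Pi.single i 1) := by
    intro i hi
    have := hrefl i (x₀ + Pi.single i 1)
    have heq : Function.update (x₀ + Pi.single i 1) i (-((x₀ + Pi.single i 1 : Site 3) i)) = x₀ - Pi.single i 1 := by
      funext j
      by_cases hj : j = i
      · subst hj
        simp [hx₀, hi]
      · simp [Pi.sub_apply, Pi.add_apply, hj]
    rw [heq] at this
    exact this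
  have hswap : criticalTwoPoint 3 (x₀ + Pi.single 2 1) = criticalTwoPoint 3 (x₀ + Pi.single 1 1) := by
    have := hperm (Equiv.swap 1 2) (x₀ + Pi.single 1 1)
    have heq : (fun i => ((x₀ + Pi.single 1 1 : Site 3) (Equiv.swap (1 : Fin 3) 2 i))) = x₀ + Pi.single 2 1 := by
      funext j
      fin_cases j <;> simp [hx₀, Equiv.swap_apply_def]
    rw [heq] at this
    exact this
  rw [Fin.sum_univ_three]
  simp only [Fin.isValue, ↓reduceIte, one_ne_zero, Fin.reduceEq, zero_add]
  rw [hneg 1 one_ne_zero, hneg 2 (by decide), hswap]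
  linarith

/-! ## The composition (kernel-checked, no sorry) -/

/-- (i) ∧ (ii) ⟹ the axial curvature bound `δ²g(k) ≤ (A₁ + 4A₂) g(k)/k²`. -/
theorem axialCurvature_of (h₁ : Statement.stub_axialKato) (h₂ : Statement.stub_transverseDipole) : AxialCurvatureBound := by
  obtain ⟨A₁, hA₁⟩ := h₁
  obtain ⟨A₂, hA₂⟩ := h₂
  refine ⟨A₁ + 4 * A₂, fun k hk => ?_⟩
  have hL := hA₁ k hk
  have hT := hA₂ k hk
  have h4 := transverse_nbrs_ge k
  set x₀ : Site 3 := Pi.single 0 (k : ℤ) with hx₀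
  have hsplit : (∑ i : Fin 3, (criticalTwoPoint 3 (x₀ + Pi.single i 1) + criticalTwoPoint 3 (x₀ - Pi.single i 1))) =
      (criticalTwoPoint 3 (x₀ + Pi.single 0 1) + criticalTwoPoint 3 (x₀ - Pi.single 0 1)) +
      ∑ i : Fin 3, if i = 0 then 0 else
        (criticalTwoPoint 3 (x₀ + Pi.single i 1) + criticalTwoPoint 3 (x₀ - Pi.single i 1)) := by
    rw [Fin.sum_univ_three, Fin.sum_univ_three]
    simp only [Fin.isValue, ↓reduceIte, one_ne_zero, Fin.reduceEq, zero_add]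
    ring
  have hplus : x₀ + Pi.single 0 1 = Pi.single 0 (((k + 1 : ℕ) : ℤ)) := by
    rw [hx₀, ← Pi.single_add]; push_cast; rfl
  have hminus : x₀ - Pi.single 0 1 = Pi.single 0 (((k - 1 : ℕ) : ℤ)) := by
    rw [hx₀, ← Pi.single_sub]
    congr 1
    push_cast [Nat.cast_sub hk]
    ring
  rw [hsplit, hplus, hminus] at hL
  have key : criticalTwoPoint 3 (Pi.single 0 ((k + 1 : ℕ) : ℤ)) - 2 * criticalTwoPoint 3 x₀ +
      criticalTwoPoint 3 (Pi.single 0 ((k - 1 : ℕ) : ℤ)) ≤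
      A₁ * criticalTwoPoint 3 x₀ / (k : ℝ) ^ 2 + 4 * (A₂ * criticalTwoPoint 3 x₀ / (k : ℝ) ^ 2) := by
    linarith
  calc _ ≤ A₁ * criticalTwoPoint 3 x₀ / (k : ℝ) ^ 2 + 4 * (A₂ * criticalTwoPoint 3 x₀ / (k : ℝ) ^ 2) := key
    _ = (A₁ + 4 * A₂) * criticalTwoPoint 3 x₀ / (k : ℝ) ^ 2 := by ring

/-- The axial curvature bound gives the crux: log-convexity `g(k)² ≤ g(k−1)g(k+1)` is exactly `(g(k) − g(k+1))² ≤ g(k+1)·δ²g(k)`,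
so `g(k) − g(k+1) ≤ √A·g(k)/k`, the log-free gradient bound; conclude by `Funnel.twoPointDoubling_iff_axisGradientRate`
(stated as the raw doubling inequality = the body of every route copy of the crux).
[AizenmanDuminilCopinAnnals2021 Prop. 5.9, Rem. 5.10] -/
theorem doubling_of_axialCurvature (h : AxialCurvatureBound) :
    ∃ κ : ℝ, 0 < κ ∧ ∀ n : ℕ, 1 ≤ n →
      κ * criticalTwoPoint 3 (Pi.single 0 (n : ℤ)) ≤ criticalTwoPoint 3 (Pi.single 0 (2 * (n : ℤ))) := by
  suffices hrate : ∃ A : ℝ, ∀ k : ℕ, 1 ≤ k →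
      criticalTwoPoint 3 (Pi.single 0 (k : ℤ)) - criticalTwoPoint 3 (Pi.single 0 ((k + 1 : ℕ) : ℤ)) ≤
        A * criticalTwoPoint 3 (Pi.single 0 (k : ℤ)) / k by
    exact Funnel.twoPointDoubling_iff_axisGradientRate.2 hrate
  obtain ⟨A, hA⟩ := h
  refine ⟨Real.sqrt (max A 0), fun k hk => ?_⟩
  have hk0 : (0 : ℝ) < k := by exact_mod_cast hk
  set a : ℝ := criticalTwoPoint 3 (Pi.single 0 ((k - 1 : ℕ) : ℤ)) with ha
  set b : ℝ := criticalTwoPoint 3 (Pi.single 0 (k : ℤ)) with hb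
  set c : ℝ := criticalTwoPoint 3 (Pi.single 0 ((k + 1 : ℕ) : ℤ)) with hc
  have hapos : 0 < a := g_pos (k - 1)
  have hbpos : 0 < b := g_pos k
  have hcpos : 0 < c := g_pos (k + 1)
  have hlc : b ^ 2 ≤ a * c := by
    have := criticalTwoPoint_axis_sq_le 0 (n := k) hk
    simpa [ha, hb, hc] using this
  have hcb : c ≤ b := by
    have := Funnel.criticalTwoPoint_axis_antitone 0 (Nat.le_succ k)
    simpa [hb, hc] using this
  have hA' : 0 ≤ max A 0 := le_max_right _ _
  have hcurv : c - 2 * b + a ≤ max A 0 * b / (k : ℝ) ^ 2 := by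
    have h1 := hA k hk
    have h2 : A * b / (k : ℝ) ^ 2 ≤ max A 0 * b / (k : ℝ) ^ 2 := by
      apply div_le_div_of_nonneg_right _ (by positivity)
      exact mul_le_mul_of_nonneg_right (le_max_left _ _) hbpos.le
    simpa [ha, hb, hc] using h1.trans h2
  have hsq : (b - c) ^ 2 ≤ max A 0 * b ^ 2 / (k : ℝ) ^ 2 := by
    have h1 : (b - c) ^ 2 ≤ c * (c - 2 * b + a) := by nlinarith
    have h2 : c * (c - 2 * b + a) ≤ b * (max A 0 * b / (k : ℝ) ^ 2) := by
      have hnn : 0 ≤ c - 2 * b + a := by nlinarith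
      exact mul_le_mul hcb hcurv hnn hbpos.le
    calc (b - c) ^ 2 ≤ b * (max A 0 * b / (k : ℝ) ^ 2) := h1.trans h2
      _ = max A 0 * b ^ 2 / (k : ℝ) ^ 2 := by ring
  have hbc : 0 ≤ b - c := by linarith
  have htarget : b - c ≤ Real.sqrt (max A 0) * b / k := by
    have hrhs : 0 ≤ Real.sqrt (max A 0) * b / k := by positivity
    have hsq' : (b - c) ^ 2 ≤ (Real.sqrt (max A 0) * b / k) ^ 2 := by
      rw [div_pow, mul_pow, Real.sq_sqrt hA']
      simpa [div_eq_mul_inv, mul_pow] using hsq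
    exact (sq_le_sq₀ hbc hrhs).1 hsq'
  simpa [hb, hc] using htarget

/-- **`TwoPointDoubling` from the stubs** (route UnitLightCone's copy, BY NAME; the home copy
`MirrorHoelderCompactness.TwoPointDoubling` has the same body, so the same term proves it). -/
theorem TwoPointDoubling_of (h₁ : Statement.stub_axialKato) (h₂ : Statement.stub_transverseDipole) :
    Summit.CriticalPhenomena.Ising3DConformalLimit.Theses.UnitLightCone.TwoPointDoubling :=
  doubling_of_axialCurvature (axialCurvature_of h₁ h₂)

end Summit.CriticalPhenomena.Ising3DConformalLimit.Cruxes.TwoPointDoubling.CurvatureSplit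

end
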